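import Literature.NumberTheory.Transcendental.AyoubPeriodSeries
import HarnessLib
import HarnessLib.Audit

/-!
# TypeAGenerationConjecture — CONJECTURE (obligation of KontsevichZagierPeriods/KontsevichZagierPeriods)

Ayoub's compact form of the period conjecture — type-(a) (Stokes-along-coordinates) generation of
the kernel of `∫_{[0,1]^∞}` on the algebra `𝒪_{k-alg}(𝔻̄^∞)` of algebraic power series on the closed
polydisc — stated over the honest objects of `Literature/NumberTheory/Transcendental/AyoubPeriodSeries.lean`
(`AyoubRel.Oan σ = 𝒪_{k-alg}(𝔻̄^∞)`, `AyoubRel.intC = ∫_{[0,1]^∞}`, `AyoubRel.relAC i` the operator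
`G ↦ ∂G/∂zᵢ − G|_{zᵢ=1} + G|_{zᵢ=0}`, `AyoubRel.kSpan σ` the `k`-span along `σ`). Unproven
conjectures are obligations of our theories, not literature facts (human ruling 2026-08-15), hence
this Summits-side conjecture LEAF (only the statement; importable by users). Routes use it as a crux
item or via `--conditional-bridge --conditional-on TypeAGenerationConjecture`; a proof would go in the
sibling `Theorems/TypeAGenerationConjectureHolds.lean` as
`theorem TypeAGenerationConjecture_holds : TypeAGenerationConjecture`.

## What is printed

* J. Ayoub, *Une version relative de la conjecture des périodes de Kontsevich–Zagier*, Ann. of Math.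
  181 (2015), **Conjecture 1.1**: for `k` a number field with a complex embedding, the kernel of
  `∫_{[0,1]^∞} : 𝒪_{k-alg}(𝔻̄^∞) → ℂ` is the `k`-subspace spanned by the elements
  `∂g/∂zᵢ − g|_{zᵢ=1} + g|_{zᵢ=0}`, `g ∈ 𝒪_{k-alg}(𝔻̄^∞)`, `i ≥ 1`; Rem. 1.2 (the holomorphic analogue
  is trivially true; "la Conjecture 1.1 a peu de chance d'être vraie si l'on fixe le nombre de
  variables à l'avance"); Fait 1.4 (equivalent to the Kontsevich–Zagier conjecture).
* J. Fresán, *Une introduction aux périodes*, Journées X-UPS (2024), **Conjecture 3.5** (pp. 35–36,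
  read on the page): "Le noyau de l'application (3.2) est le `ℚ`-sous-espace vectoriel de
  `𝒪_{ℚ-alg}(𝔻̄^∞)` engendré par les éléments de la forme `∂g/∂zᵢ − g|_{zᵢ=1} + g|_{zᵢ=0}`, où `g` est
  une fonction dans `𝒪_{ℚ-alg}(𝔻̄^∞)` et `i ≥ 1` est un entier" (`𝒪_{ℚ-alg}(𝔻̄ⁿ)`: power series of
  polyradius of convergence `> 1`, algebraic over `ℚ(z₁, …, zₙ)`, p. 35); Rem. 3.6–3.7.

## Lean rendering and users

ONE closed statement quantified over every field `k` of characteristic `0` and every embedding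
`σ : k →+* ℂ` with algebraic image (`∀ c, IsAlgebraic ℚ (σ c)`). Instances: `k` a number field
(Ayoub's printed Conj. 1.1, every instance), `k = ℚ` (Fresán's printed Conj. 3.5), `k = ℚ̄ =
algebraicClosure ℚ ℂ` (the instance used by the line `Sketch` of crux `StokesGeneration`,
stmt-KontsevichZagierPeriods-3586, where this statement is the registered stub `stub_typeAGeneration`,
verbatim). Conversely the number-field instances give the statement for every `k` with algebraic
image (the finitely many coefficients of an algebraic relation of `F` over `k(z)` generate a number
field `K ⊆ σ(k)`, `F ∈ 𝒪_{K-alg}`, and a `K`-combination is a `k`-combination), so the rendering is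
equivalent to the conjunction of the printed instances.
-- TODO(general form): that descent (`TypeAGenerationConjecture ↔ ∀ number fields`) is not formalised.
The hypothesis "algebraic image" is load-bearing (over `k = ℝ`, `ℂ` the statement is false, as the
naive real-coefficient period conjecture is — Lindemann; while for ALL holomorphic germs with the
`ℂ`-span it is trivially true, Rem. 1.2 / Rem. 3.6), and the number of auxiliary variables cannot be
bounded (`Literature.Barriers.KontsevichZagierPeriods.KZ.kernelElt_not_stokes_one_variable`, proved).
The elementary inclusion `⟨type (a)⟩_k ⊆ ker ∫` is `AyoubRel.intC_relAC_eq_zero` (proved, tree).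

Status: OPEN, of Grothendieck-period-conjecture strength: with the cube–Nash normal form
(`Theses/LiftingCriteria.lean`, `CubeNashNormalForm`) it implies `KZKernelConjecture`, hence the summit
(`Theorems/UnfoldedStokesStokesGenerationLineReduction.lean`); the barriers
`Literature.Barriers.KontsevichZagierPeriods.kzConjecture_implies_*` apply. Never asserted.
-/

-- `Summit.KontsevichZagierPeriods.KontsevichZagierPeriods.…` is the tree's mandated layout (single-conjunct summit).
set_option linter.dupNamespace false

namespace Summit.KontsevichZagierPeriods.KontsevichZagierPeriods

open Literature.NumberTheory.Transcendental
open Literature.NumberTheory.Transcendental.AyoubRel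

/-- OPEN CONJECTURE — **Ayoub's Conjecture 1.1 / Fresán's Conjecture 3.5 (type-(a) generation of
the kernel of `∫_{[0,1]^∞}` on `𝒪_{k-alg}(𝔻̄^∞)`).** For every field `k` of characteristic `0` and
every embedding `σ : k →+* ℂ` whose image consists of algebraic numbers, every
`F ∈ 𝒪_{k-alg}(𝔻̄^∞)` (`AyoubRel.Oan σ`: power series in finitely many variables, polyradius of
convergence `> 1`, algebraic over `k(z)`) with `∫_{[0,1]^∞} F = 0` (`AyoubRel.intC`) is a `k`-linear
combination of elements `∂G/∂zᵢ − G|_{zᵢ=1} + G|_{zᵢ=0}` (`AyoubRel.relAC i G`) with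
`G ∈ 𝒪_{k-alg}(𝔻̄^∞)`, `i : ℕ`. Printed for `k` a number field (Ayoub 2015, Conj. 1.1) and for
`k = ℚ` (Fresán 2024, Conj. 3.5, pp. 35–36); the quantification over all `k` with algebraic image is
equivalent to the conjunction of the number-field instances (module docstring). Posed, not proved;
equivalent to the Kontsevich–Zagier period conjecture (Ayoub 2015, Fait 1.4), so no `_holds`
discharge is expected from the literature; in-tree results take it as an explicit hypothesis
`(h : TypeAGenerationConjecture)`. Registered as an open statement (CONVENTIONS §4).
[cite: Ayoub2015, Conj. 1.1] [status: open] -/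
@[conjecture] def TypeAGenerationConjecture : Prop :=
  ∀ (k : Type) [Field k] [CharZero k] (σ : k →+* ℂ), (∀ c : k, IsAlgebraic ℚ (σ c)) →
    ∀ F ∈ Oan σ, intC F = 0 →
      F ∈ kSpan σ {x : CSeries | ∃ G ∈ Oan σ, ∃ i : ℕ, x = relAC i G}

/-- The registered stub `stub_typeAGeneration` of crux stmt-KontsevichZagierPeriods-3586 (line `Sketch`,
`Cruxes/StokesGeneration/Lines/Sketch.lean`) is this conjecture, verbatim (definitional unfolding; recorded
so that summit-side users may rewrite either way). [cite: Ayoub2015, Conj. 1.1] -/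
theorem typeAGenerationConjecture_iff_stub : TypeAGenerationConjecture ↔ (∀ (k : Type) [Field k] [CharZero k] (σ : k →+* ℂ), (∀ c : k, IsAlgebraic ℚ (σ c)) → ∀ F ∈ AyoubRel.Oan σ, AyoubRel.intC F = 0 → F ∈ AyoubRel.kSpan σ {x : AyoubRel.CSeries | ∃ G ∈ AyoubRel.Oan σ, ∃ i : ℕ, x = AyoubRel.relAC i G}) :=
  Iff.rfl

end Summit.KontsevichZagierPeriods.KontsevichZagierPeriods
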